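import Mathlib
import Summits.Ventures.HodgeRepro.Tier4.Common.MixedPlane
import Summits.Ventures.HodgeRepro.Tier4.Common.PlaneGenuine
import Summits.Ventures.HodgeRepro.Tier4.Common.MixedPlaneKType
import Summits.Ventures.HodgeRepro.Tier4.Common.PlaneTransport

/-!
# Tier4/Common/RowPlane — the planes of the face in the ROW convention of the landed group `unitaryGroup`
(the Common side of t4-crit-2's O-L4-2, S12571; the convention ruling S12538 «ROW stays»; L1-p3's S12500)

Blind re-derivation cell `pub-hodge-repro`, Tier 4 (README §9–§10), seat t4-typer-2 (gen 2).  Target tree path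
`lean/Summits/Ventures/HodgeRepro/Tier4/Common/RowPlane.lean`.  Imports `MixedPlane` (`QuadData`, `omegaMat`,
`lineGram`, `blockDiag4`, `PlaneData.ofLines`), `PlaneGenuine` (`IsGenuinePlane`, `ofLines_isGenuine`, the
block-diagonal lemmas), `MixedPlaneKType` (`PlaneData.withTransportedTorus`), `PlaneTransport`
(`withTransportedTorus_isGenuine`).

THE DEFECT.  `unitaryGroup W = {g | g Ω = Ω g ∧ g B gᵀ = B}` (AdelicDefs, landed) is the isometry group of the
bilinear form `(u, v) ↦ u B vᵀ` on ROW vectors; the planes `PlaneData.ofLines` / `seesaw` / `mixed` (MixedPlane) carry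
the trace-form Gram matrix in the basis `(1, ω)` of each line for COLUMN vectors (`Ωᵀ B = B (t − Ω)`, PlaneGenuine
`IsHermitianPlane`).  Fed to the row group, such a plane has a degenerate «unitary group» (on a line, `x + y Ω`
preserves `a • !![2, t; t, 2n]` only for `y = 0`, `x = ±1` — crit-2's certificate).

THE REPAIR (this file): keep `Ω`, `P`, `Q` — hence every landed predicate on `GA W`, `torusT W`, `localTorusAt`,
`weightAt`, `HasKTypeAt`, `ChiMatchesAt`, … — and change ONLY the Gram matrix.  In the basis `(−c(ω), 1)` of the line
`E′ = k ⊕ k ω` (with `c(ω) = t − ω`), RIGHT multiplication by `ω` on row vectors has the landed matrix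
`omegaMat q = !![0, −n; 1, t]` (`(−c(ω)) ω = −n`, `1 · ω = −(−c(ω)) + t`), and the trace form `Tr(a x c(y))` of
the hermitian line `⟨a⟩` has the Gram matrix **`lineGramRow q a := a • !![2n, −t; −t, 2]`** (`Tr(a c(ω) ω) = 2an`,
`Tr(−a c(ω)) = −at`, `Tr(a) = 2a`).  Right multiplication by `α = p + q ω` is the block `p • 1 + q • omegaMat q`
(`(−c(ω)) α = p (−c(ω)) − q n`, `1 · α = q (−c(ω)) + (p + t q)`), so a torus element still reads `weightAt = p + q ω_w`.
`PlaneData.ofLinesRow q a b ε` is `ofLines` with this Gram; `IsHermitianPlaneRow q W` is the row compatibility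
`Ω B = B (t − Ωᵀ)` (for `t = 0`: `Ω B = −B Ωᵀ`, the relation of L1's PlaneDefs v0.2 `IsGenuineRow`, S12500 (3)), proved
for `ofLinesRow` and preserved by `withTransportedTorus`.

ACCEPTANCE TEST (kernel): `normForm_mul_lineGramRow` — `(x • 1 + y • Ω) G (x • 1 + y • Ω)ᵀ = (x² + t x y + n y²) • G`
for the row Gram `G = lineGramRow q a`; hence `rowIsometry_iff_norm_one`: the block preserves `G` iff
`N(x + y ω) = 1` — the norm-one torus, not `{±1}`.  DICTIONARY: `lineGramRow q a * lineGram q a = a² (4n − t²) • 1`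
(the row Gram is the adjugate of the column Gram), so `g G_r gᵀ = G_r ⟺ (g⁻¹)ᵀ G_c g⁻¹ = G_c`: on each line the row
group of `⟨a⟩` is the column group of `⟨a⟩` as a set of matrices.

Nothing here says anything about the status of the Hodge conjecture for CM abelian varieties, which is NOT proved
(HC_CM is NOT proved by anyone in this repository).
-/

set_option autoImplicit false

noncomputable section

namespace Summit.Ventures.HodgeRepro.Tier4.Common

open Matrix

section RowLine

variable {k : Type} [Field k] (q : QuadData k)

/-- **The row Gram matrix of the hermitian line `⟨a⟩`**: the trace form `Tr_{E′/k}(a x c(y))` in the basis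
`(−c(ω), 1)`, in which right multiplication by `ω` is `omegaMat q`. -/
def lineGramRow (a : k) : Matrix (Fin 2) (Fin 2) k := a • !![2 * q.n, -q.t; -q.t, 2]

/-- The row Gram matrix is symmetric. -/
theorem lineGramRow_transpose (a : k) : (lineGramRow q a)ᵀ = lineGramRow q a := by
  ext i j
  fin_cases i <;> fin_cases j <;> simp [lineGramRow]

/-- The determinant of the row Gram matrix: `a² (4 n − t²)` (the same as the column Gram's). -/
theorem det_lineGramRow (a : k) : (lineGramRow q a).det = a ^ 2 * (4 * q.n - q.t ^ 2) := by
  simp only [lineGramRow, Matrix.det_smul, Fintype.card_fin, Matrix.det_fin_two_of]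
  ring

/-- **Dictionary**: the row Gram is the adjugate of the column Gram — `G_r G_c = a² (4 n − t²) • 1`. -/
theorem lineGramRow_mul_lineGram (a : k) :
    lineGramRow q a * lineGram q a = (a ^ 2 * (4 * q.n - q.t ^ 2)) • (1 : Matrix (Fin 2) (Fin 2) k) := by
  ext i j
  fin_cases i <;> fin_cases j <;>
    simp [lineGramRow, lineGram, Matrix.mul_apply, Fin.sum_univ_two] <;> ring

/-- **The row compatibility on one line**: `ω G_r = G_r (t − ωᵀ)`. -/
theorem omegaMat_mul_lineGramRow (a : k) :
    omegaMat q * lineGramRow q a = lineGramRow q a * (q.t • (1 : Matrix (Fin 2) (Fin 2) k) - (omegaMat q)ᵀ) := by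
  ext i j
  fin_cases i <;> fin_cases j <;>
    simp [omegaMat, lineGramRow, Matrix.mul_apply, Fin.sum_univ_two, Matrix.one_apply] <;> ring

/-- **The acceptance test**: the block `x • 1 + y • Ω` of right multiplication by `x + y ω` transforms the row Gram
by the norm `N(x + y ω) = x² + t x y + n y²`: `M G_r Mᵀ = N • G_r`. -/
theorem normForm_mul_lineGramRow (a x y : k) :
    (x • (1 : Matrix (Fin 2) (Fin 2) k) + y • omegaMat q) * lineGramRow q a *
        (x • (1 : Matrix (Fin 2) (Fin 2) k) + y • omegaMat q)ᵀ =
      (x ^ 2 + q.t * x * y + q.n * y ^ 2) • lineGramRow q a := by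
  ext i j
  fin_cases i <;> fin_cases j <;>
    simp [omegaMat, lineGramRow, Matrix.mul_apply, Fin.sum_univ_two, Matrix.one_apply] <;> ring

/-- The `(1, 1)` entry of the row Gram matrix is `2a`. -/
theorem lineGramRow_apply_one_one (a : k) : lineGramRow q a 1 1 = a * 2 := by
  simp [lineGramRow]

/-- **The torus block preserves the row Gram iff its norm is `1`** — the norm-one torus `U(1)` of `E′/k`, not `{±1}`
(in characteristic `0`, for `a ≠ 0`). -/
theorem rowIsometry_iff_norm_one [CharZero k] (a x y : k) (ha : a ≠ 0) :
    (x • (1 : Matrix (Fin 2) (Fin 2) k) + y • omegaMat q) * lineGramRow q a *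
        (x • (1 : Matrix (Fin 2) (Fin 2) k) + y • omegaMat q)ᵀ = lineGramRow q a ↔
      x ^ 2 + q.t * x * y + q.n * y ^ 2 = 1 := by
  rw [normForm_mul_lineGramRow]
  constructor
  · intro h
    have h11 := congrFun (congrFun h 1) 1
    rw [Matrix.smul_apply, lineGramRow_apply_one_one, smul_eq_mul] at h11
    have h2a : a * 2 ≠ 0 := mul_ne_zero ha two_ne_zero
    exact mul_right_cancel₀ h2a (by linear_combination h11)
  · intro h
    rw [h, one_smul]

end RowLine

section RowPlane

variable {k : Type} [Field k] (q : QuadData k)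

/-- **The plane `⟨a⟩ ⊕ ⟨ε b⟩` in the ROW convention**: the Gram matrix `blockDiag4 (lineGramRow q a) (ε • lineGramRow q b)`,
`Ω`, `P`, `Q` exactly those of `PlaneData.ofLines` (`ε = 1`: the seesaw plane, `ε = −1`: the mixed plane). -/
def PlaneData.ofLinesRow (a b ε : k) : PlaneData k where
  B := blockDiag4 (lineGramRow q a) (ε • lineGramRow q b)
  Ω := blockDiag4 (omegaMat q) (omegaMat q)
  P := ![blockDiag4 1 0, blockDiag4 0 1]
  Q := ![blockDiag4 1 0, blockDiag4 0 1]
  B_symm := by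
    rw [blockDiag4_transpose, lineGramRow_transpose, transpose_smul, lineGramRow_transpose]
  P_comm := (PlaneData.ofLines q a b ε).P_comm
  Q_comm := (PlaneData.ofLines q a b ε).Q_comm
  P_idem := (PlaneData.ofLines q a b ε).P_idem
  Q_idem := (PlaneData.ofLines q a b ε).Q_idem
  P_sum := (PlaneData.ofLines q a b ε).P_sum
  Q_sum := (PlaneData.ofLines q a b ε).Q_sum

/-- The seesaw plane `W_a ⊕ W_b`, row convention. -/
def PlaneData.seesawRow (a b : k) : PlaneData k := PlaneData.ofLinesRow q a b 1

/-- **The mixed plane `W_a ⊕ W_b⁻` of line L4, row convention.** -/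
def PlaneData.mixedRow (a b : k) : PlaneData k := PlaneData.ofLinesRow q a b (-1)

/-- `Ω` is unchanged. -/
theorem ofLinesRow_Ω (a b ε : k) : (PlaneData.ofLinesRow q a b ε).Ω = (PlaneData.ofLines q a b ε).Ω := rfl

/-- The projectors `P` are unchanged. -/
theorem ofLinesRow_P (a b ε : k) : (PlaneData.ofLinesRow q a b ε).P = (PlaneData.ofLines q a b ε).P := rfl

/-- The projectors `Q` are unchanged. -/
theorem ofLinesRow_Q (a b ε : k) : (PlaneData.ofLinesRow q a b ε).Q = (PlaneData.ofLines q a b ε).Q := rfl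

/-- The row Gram matrix of the plane. -/
theorem ofLinesRow_B (a b ε : k) :
    (PlaneData.ofLinesRow q a b ε).B = blockDiag4 (lineGramRow q a) (ε • lineGramRow q b) := rfl

/-- **A genuine plane in the ROW convention**: genuine, and `B` is the row trace form of a hermitian form:
`Ω B = B (t • 1 − Ωᵀ)` (for `t = 0`: `Ω B = −B Ωᵀ`, L1's `IsGenuineRow` relation). -/
def IsHermitianPlaneRow (W : PlaneData k) : Prop :=
  IsGenuinePlane q W ∧ W.Ω * W.B = W.B * (q.t • (1 : Matrix (Fin 4) (Fin 4) k) - W.Ωᵀ)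

/-- For `t = 0` the row compatibility is `Ω B = −B Ωᵀ`. -/
theorem IsHermitianPlaneRow.omega_mul_B_of_t_eq_zero {W : PlaneData k} (h : IsHermitianPlaneRow q W)
    (ht : q.t = 0) : W.Ω * W.B = -(W.B * W.Ωᵀ) := by
  rw [h.2, ht, zero_smul, zero_sub, Matrix.mul_neg]

/-- The row plane is genuine (`a, b, ε ≠ 0`, `t² ≠ 4 n`): `Ω`, `P`, `Q` are those of `ofLines`, and the row Gram has
the same determinant. -/
theorem ofLinesRow_isGenuine (a b ε : k) (ha : a ≠ 0) (hb : b ≠ 0) (hε : ε ≠ 0)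
    (hq : q.t ^ 2 - 4 * q.n ≠ 0) : IsGenuinePlane q (PlaneData.ofLinesRow q a b ε) := by
  obtain ⟨h1, h2, h3, h4, -⟩ := ofLines_isGenuine q a b ε ha hb hε hq
  refine ⟨h1, h2, h3, h4, ?_⟩
  show (blockDiag4 (lineGramRow q a) (ε • lineGramRow q b)).det ≠ 0
  rw [det_blockDiag4, Matrix.det_smul, det_lineGramRow, det_lineGramRow, Fintype.card_fin]
  have h4n : 4 * q.n - q.t ^ 2 ≠ 0 := by
    intro h0; apply hq; linear_combination -h0
  apply mul_ne_zero
  · exact mul_ne_zero (pow_ne_zero 2 ha) h4n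
  · exact mul_ne_zero (pow_ne_zero 2 hε) (mul_ne_zero (pow_ne_zero 2 hb) h4n)

/-- **The row planes are hermitian in the row convention.** -/
theorem ofLinesRow_isHermitianRow (a b ε : k) (ha : a ≠ 0) (hb : b ≠ 0) (hε : ε ≠ 0)
    (hq : q.t ^ 2 - 4 * q.n ≠ 0) : IsHermitianPlaneRow q (PlaneData.ofLinesRow q a b ε) := by
  refine ⟨ofLinesRow_isGenuine q a b ε ha hb hε hq, ?_⟩
  show blockDiag4 (omegaMat q) (omegaMat q) * blockDiag4 (lineGramRow q a) (ε • lineGramRow q b) =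
    blockDiag4 (lineGramRow q a) (ε • lineGramRow q b) *
      (q.t • (1 : Matrix (Fin 4) (Fin 4) k) - (blockDiag4 (omegaMat q) (omegaMat q))ᵀ)
  rw [blockDiag4_transpose, blockDiag4_mul, ← blockDiag4_one, blockDiag4_smul, blockDiag4_sub, blockDiag4_mul,
    omegaMat_mul_lineGramRow]
  congr 1
  rw [Matrix.mul_smul, Matrix.smul_mul, omegaMat_mul_lineGramRow]

/-- The seesaw plane, row convention, is hermitian. -/
theorem seesawRow_isHermitianRow (a b : k) (ha : a ≠ 0) (hb : b ≠ 0) (hq : q.t ^ 2 - 4 * q.n ≠ 0) :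
    IsHermitianPlaneRow q (PlaneData.seesawRow q a b) :=
  ofLinesRow_isHermitianRow q a b 1 ha hb one_ne_zero hq

/-- The mixed plane, row convention, is hermitian. -/
theorem mixedRow_isHermitianRow (a b : k) (ha : a ≠ 0) (hb : b ≠ 0) (hq : q.t ^ 2 - 4 * q.n ≠ 0) :
    IsHermitianPlaneRow q (PlaneData.mixedRow q a b) :=
  ofLinesRow_isHermitianRow q a b (-1) ha hb (neg_ne_zero.mpr one_ne_zero) hq

/-- **Transporting the second torus preserves row-hermitianity** (`B`, `Ω` are unchanged by the transport). -/
theorem withTransportedTorus_isHermitianRow (W : PlaneData k) (hW : IsHermitianPlaneRow q W)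
    (g g' : Matrix (Fin 4) (Fin 4) k) (hgg' : g * g' = 1) (hg'g : g' * g = 1) (hgΩ : g * W.Ω = W.Ω * g) :
    IsHermitianPlaneRow q (W.withTransportedTorus g g' hgg' hg'g hgΩ) :=
  ⟨withTransportedTorus_isGenuine q W hW.1 g g' hgg' hg'g hgΩ, hW.2⟩

/-- **L4's plane in the row convention is hermitian with no hypothesis**: the mixed row plane with a transported
torus. -/
theorem mixedRow_withTransportedTorus_isHermitianRow (a b : k) (ha : a ≠ 0) (hb : b ≠ 0)
    (hq : q.t ^ 2 - 4 * q.n ≠ 0) (g g' : Matrix (Fin 4) (Fin 4) k) (hgg' : g * g' = 1) (hg'g : g' * g = 1)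
    (hgΩ : g * (PlaneData.mixedRow q a b).Ω = (PlaneData.mixedRow q a b).Ω * g) :
    IsHermitianPlaneRow q ((PlaneData.mixedRow q a b).withTransportedTorus g g' hgg' hg'g hgΩ) :=
  withTransportedTorus_isHermitianRow q _ (mixedRow_isHermitianRow q a b ha hb hq) g g' hgg' hg'g hgΩ

/-- The projectors of the row plane satisfy L1's projector clause `P B = B Pᵀ` (block-diagonal, symmetric). -/
theorem ofLinesRow_P_mul_B (a b ε : k) (i : Fin 2) :
    (PlaneData.ofLinesRow q a b ε).P i * (PlaneData.ofLinesRow q a b ε).B =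
      (PlaneData.ofLinesRow q a b ε).B * ((PlaneData.ofLinesRow q a b ε).P i)ᵀ := by
  fin_cases i
  · show blockDiag4 1 0 * blockDiag4 (lineGramRow q a) (ε • lineGramRow q b) =
      blockDiag4 (lineGramRow q a) (ε • lineGramRow q b) * (blockDiag4 1 0)ᵀ
    rw [blockDiag4_transpose, blockDiag4_mul, blockDiag4_mul, Matrix.transpose_one, Matrix.transpose_zero,
      Matrix.one_mul, Matrix.mul_one, Matrix.zero_mul, Matrix.mul_zero]
  · show blockDiag4 0 1 * blockDiag4 (lineGramRow q a) (ε • lineGramRow q b) =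
      blockDiag4 (lineGramRow q a) (ε • lineGramRow q b) * (blockDiag4 0 1)ᵀ
    rw [blockDiag4_transpose, blockDiag4_mul, blockDiag4_mul, Matrix.transpose_one, Matrix.transpose_zero,
      Matrix.one_mul, Matrix.mul_one, Matrix.zero_mul, Matrix.mul_zero]

end RowPlane

/-! ## v0.2 (append): the same identities over any commutative ring — for the adelic blocks

The torus `torusT W` of the row plane lives in `GL₄(𝔸_k)`; its elements commute with `Ω` and with the projectors, so
their block on a line is a `2 × 2` matrix over the RING `𝔸_k` commuting with `omegaMat q` — i.e. of the form
`x • 1 + y • Ω` (`commute_omegaMatR_iff`, over any commutative ring) — and it preserves the row Gram iff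
`N(x + y ω) = x² + t x y + n y² = 1` in `𝔸_k` (`normForm_mul_lineGramRowR`), i.e. componentwise at every place:
at a complex place the unit circle `|α_w|² = 1`.  `omegaMat_map` / `lineGramRow_map` transport the `k`-matrices
along any ring homomorphism (e.g. `algebraMap k (Ad k)`, `adComponentInf w`). -/

section Ring

variable {R : Type} [CommRing R]

/-- `omegaMat` over a ring: the matrix of `ω` with `ω² = t ω − n`. -/
def omegaMatR (t n : R) : Matrix (Fin 2) (Fin 2) R := !![0, -n; 1, t]

/-- The row Gram matrix of `⟨a⟩` over a ring. -/
def lineGramRowR (t n a : R) : Matrix (Fin 2) (Fin 2) R := a • !![2 * n, -t; -t, 2]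

/-- `omegaMat` transports along ring homomorphisms. -/
theorem omegaMat_map {k : Type} [Field k] (q : QuadData k) (f : k →+* R) :
    (omegaMat q).map f = omegaMatR (f q.t) (f q.n) := by
  ext i j
  fin_cases i <;> fin_cases j <;> simp [omegaMat, omegaMatR]

/-- `lineGramRow` transports along ring homomorphisms. -/
theorem lineGramRow_map {k : Type} [Field k] (q : QuadData k) (f : k →+* R) (a : k) :
    (lineGramRow q a).map f = lineGramRowR (f q.t) (f q.n) (f a) := by
  ext i j
  fin_cases i <;> fin_cases j <;> simp [lineGramRow, lineGramRowR, map_ofNat]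

/-- **A `2 × 2` matrix commutes with `Ω` iff it is `x • 1 + y • Ω`** (with `x = M 0 0`, `y = M 1 0`), over any
commutative ring — the shape of every torus block. -/
theorem commute_omegaMatR_iff (t n : R) (M : Matrix (Fin 2) (Fin 2) R) :
    M * omegaMatR t n = omegaMatR t n * M ↔ M = M 0 0 • (1 : Matrix (Fin 2) (Fin 2) R) + M 1 0 • omegaMatR t n := by
  constructor
  · intro h
    have h00 := congrFun (congrFun h 0) 0
    have h10 := congrFun (congrFun h 1) 0
    simp [omegaMatR, Matrix.mul_apply, Fin.sum_univ_two] at h00 h10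
    ext i j
    fin_cases i <;> fin_cases j <;> simp [omegaMatR]
    · linear_combination h00
    · linear_combination h10
  · intro h
    rw [h]
    simp only [Matrix.add_mul, Matrix.mul_add, Matrix.smul_mul, Matrix.mul_smul, Matrix.one_mul, Matrix.mul_one]

/-- **The acceptance test over any commutative ring**: `(x • 1 + y • Ω) G_r (x • 1 + y • Ω)ᵀ = (x² + t x y + n y²) • G_r`. -/
theorem normForm_mul_lineGramRowR (t n a x y : R) :
    (x • (1 : Matrix (Fin 2) (Fin 2) R) + y • omegaMatR t n) * lineGramRowR t n a *
        (x • (1 : Matrix (Fin 2) (Fin 2) R) + y • omegaMatR t n)ᵀ =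
      (x ^ 2 + t * x * y + n * y ^ 2) • lineGramRowR t n a := by
  ext i j
  fin_cases i <;> fin_cases j <;>
    simp [omegaMatR, lineGramRowR, Matrix.mul_apply, Fin.sum_univ_two] <;> ring

/-- The row compatibility `Ω G_r = G_r (t − Ωᵀ)` over any commutative ring. -/
theorem omegaMatR_mul_lineGramRowR (t n a : R) :
    omegaMatR t n * lineGramRowR t n a = lineGramRowR t n a * (t • (1 : Matrix (Fin 2) (Fin 2) R) - (omegaMatR t n)ᵀ) := by
  ext i j
  fin_cases i <;> fin_cases j <;>
    simp [omegaMatR, lineGramRowR, Matrix.mul_apply, Fin.sum_univ_two] <;> ring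

end Ring

end Summit.Ventures.HodgeRepro.Tier4.Common

end
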